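import Summits.CriticalPhenomena.PercolationContinuityZ3.Theorems.PercNearOneGluingNoHeavyLowerTailThresholdRABArc
import Mathlib.Data.ZMod.Basic
import Mathlib.Order.UpperLower.Basic

/-!
# `NoHeavyLowerTail` (crux stmt-CriticalPhenomena-4575), lane prim-ineq-gen-4 (gen 18): Katona's circle for the half-cube lemma —
# the arc system of a down-closed, non-covering family on `ZMod (2m)`

Support file (`--supports stmt-CriticalPhenomena-4575`; memo `run/shared/lean/prim/prim-ineq-gen-4/PROOFS-RAB-ALL-K-g18.md` §2).
No definitions, no `sorry`, standard axioms.

For a lower set `G` of finsets of `ZMod (2m)` no two members of which cover everything, the numbers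
`b j = #{s : arc s j ∈ G}` of member ARCS `arc s j = {s, s+1, …, s+j-1}` (written inline as an image of `range j`) satisfy the
hypotheses of `arc_ineq_abstract` (companion file `…ThresholdRABArc`): monotone with unit drops (`card_arcStarts_succ_lt`), and
`2·b m ≤ 2m` (an arc of length `m` and its antipode cover the cycle).  Conclusion `arc_ineq_family`:
`Σ_{m ≤ j < 2m} C(2m,j)·b j ≤ 2m + Σ_{1 ≤ j < m} C(2m,j)·b j`.
-/

namespace Summit.CriticalPhenomena.PercolationContinuityZ3.Theorems.ThresholdRAB

open Finset

section Circle

variable {n : ℕ} [NeZero n]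

omit [NeZero n] in
/-- `arc s j ⊆ arc s (j+1)`. [folklore] -/
theorem arc_subset_succ (s : ZMod n) (j : ℕ) :
    (range j).image (fun i : ℕ => s + (i : ZMod n)) ⊆ (range (j + 1)).image (fun i : ℕ => s + (i : ZMod n)) :=
  image_subset_image (range_subset_range.2 (Nat.le_succ j))

omit [NeZero n] in
/-- `arc (s+1) j ⊆ arc s (j+1)`. [folklore] -/
theorem arc_shift_subset_succ (s : ZMod n) (j : ℕ) :
    (range j).image (fun i : ℕ => s + 1 + (i : ZMod n)) ⊆ (range (j + 1)).image (fun i : ℕ => s + (i : ZMod n)) := by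
  intro x hx
  rw [mem_image] at hx ⊢
  obtain ⟨i, hi, rfl⟩ := hx
  refine ⟨i + 1, by rw [mem_range] at hi ⊢; omega, ?_⟩
  push_cast; ring

/-- Every point of the cycle lies in `arc s m ∪ arc (s + m) m` when `n = 2m`. [folklore] -/
theorem mem_arc_union_arc_antipode {m : ℕ} (hn : n = 2 * m) (s x : ZMod n) :
    x ∈ (range m).image (fun i : ℕ => s + (i : ZMod n)) ∪ (range m).image (fun i : ℕ => s + (m : ZMod n) + (i : ZMod n)) := by
  rw [mem_union, mem_image, mem_image]
  obtain ⟨v, hvn, hxv⟩ : ∃ v : ℕ, v < n ∧ x = s + (v : ZMod n) :=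
    ⟨(x - s).val, ZMod.val_lt _, by rw [ZMod.natCast_zmod_val]; ring⟩
  by_cases h : v < m
  · exact Or.inl ⟨v, mem_range.2 h, hxv.symm⟩
  · refine Or.inr ⟨v - m, mem_range.2 (by omega), ?_⟩
    rw [hxv]
    have hv : (v : ZMod n) = (m : ZMod n) + ((v - m : ℕ) : ZMod n) := by
      rw [← Nat.cast_add]; congr 1; omega
    rw [hv]; ring

/-- A nonempty set of residues closed under `s ↦ s + 1` is everything. [folklore] -/
theorem eq_univ_of_succ_mem {S : Finset (ZMod n)} (hS : ∀ s ∈ S, s + 1 ∈ S) (hne : S.Nonempty) : S = univ := by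
  obtain ⟨s₀, hs₀⟩ := hne
  have key : ∀ i : ℕ, s₀ + (i : ZMod n) ∈ S := by
    intro i
    induction i with
    | zero => simpa using hs₀
    | succ i ih => have := hS _ ih; push_cast; rwa [← add_assoc]
  refine eq_univ_of_forall fun x => ?_
  have hx : x = s₀ + (((x - s₀).val : ℕ) : ZMod n) := by rw [ZMod.natCast_zmod_val]; ring
  rw [hx]; exact key _

/-- Growth: if `∅ ≠ S ≠ univ` then `S ∪ (S + 1)` has more than `#S` elements. [this work] -/
theorem card_lt_card_union_image_succ {S : Finset (ZMod n)} (hne : S.Nonempty) (hS : S ≠ univ) :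
    #S < #(S ∪ S.image (fun s => s + 1)) := by
  by_contra h
  have hle : #(S ∪ S.image (fun s => s + 1)) ≤ #S := not_lt.1 h
  have heq : S ∪ S.image (fun s => s + 1) = S :=
    (eq_of_subset_of_card_le (subset_union_left (s₁ := S) (s₂ := S.image (fun s => s + 1))) hle).symm
  have hsub : ∀ s ∈ S, s + 1 ∈ S := by
    intro s hs
    have : s + 1 ∈ S ∪ S.image (fun s => s + 1) := mem_union_right _ (mem_image_of_mem (fun s => s + 1) hs)
    rwa [heq] at this
  exact hS (eq_univ_of_succ_mem hsub hne)

variable (G : Finset (Finset (ZMod n)))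

/-- Monotonicity of arc counts: `b (j+1) ≤ b j` for a lower set. [this work] -/
theorem card_arcStarts_succ_le (hG : IsLowerSet (G : Set (Finset (ZMod n)))) (j : ℕ) :
    #(univ.filter fun s : ZMod n => (range (j + 1)).image (fun i : ℕ => s + (i : ZMod n)) ∈ G)
      ≤ #(univ.filter fun s : ZMod n => (range j).image (fun i : ℕ => s + (i : ZMod n)) ∈ G) := by
  refine card_le_card fun s hs => ?_
  rw [mem_filter] at hs ⊢
  exact ⟨hs.1, hG (arc_subset_succ s j) hs.2⟩

/-- Unit drop of arc counts: if `0 < b (j+1) < n` then `b (j+1) + 1 ≤ b j` for a lower set (the starts of member arcs of length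
`j+1`, together with their successors, are starts of member arcs of length `j`). [this work] -/
theorem card_arcStarts_succ_lt (hG : IsLowerSet (G : Set (Finset (ZMod n)))) (j : ℕ)
    (hpos : 0 < #(univ.filter fun s : ZMod n => (range (j + 1)).image (fun i : ℕ => s + (i : ZMod n)) ∈ G))
    (hlt : #(univ.filter fun s : ZMod n => (range (j + 1)).image (fun i : ℕ => s + (i : ZMod n)) ∈ G) < n) :
    #(univ.filter fun s : ZMod n => (range (j + 1)).image (fun i : ℕ => s + (i : ZMod n)) ∈ G) + 1
      ≤ #(univ.filter fun s : ZMod n => (range j).image (fun i : ℕ => s + (i : ZMod n)) ∈ G) := by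
  set S := univ.filter fun s : ZMod n => (range (j + 1)).image (fun i : ℕ => s + (i : ZMod n)) ∈ G with hSdef
  have hne : S.Nonempty := card_pos.1 hpos
  have hSu : S ≠ univ := by
    intro h; rw [h, card_univ, ZMod.card] at hlt; exact lt_irrefl _ hlt
  have hgrow := card_lt_card_union_image_succ hne hSu
  have hsub : S ∪ S.image (fun s => s + 1) ⊆ univ.filter fun s : ZMod n => (range j).image (fun i : ℕ => s + (i : ZMod n)) ∈ G := by
    intro s hs
    rw [mem_filter]
    refine ⟨mem_univ _, ?_⟩
    rcases mem_union.1 hs with h | h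
    · rw [hSdef, mem_filter] at h
      exact hG (arc_subset_succ s j) h.2
    · rw [mem_image] at h
      obtain ⟨s', hs', rfl⟩ := h
      rw [hSdef, mem_filter] at hs'
      exact hG (arc_shift_subset_succ s' j) hs'.2
  have := card_le_card hsub
  omega

/-- Antipodes: if no two members of `G` cover the cycle (`n = 2m`), at most `m` arcs of length `m` are members. [this work] -/
theorem two_mul_card_arcStarts_mid_le {m : ℕ} (hn : n = 2 * m)
    (hGG : ∀ x ∈ G, ∀ y ∈ G, x ∪ y ≠ univ) :
    2 * #(univ.filter fun s : ZMod n => (range m).image (fun i : ℕ => s + (i : ZMod n)) ∈ G) ≤ 2 * m := by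
  set T := univ.filter fun s : ZMod n => (range m).image (fun i : ℕ => s + (i : ZMod n)) ∈ G with hT
  -- `s ↦ s + m` maps `T` injectively into its complement
  have hmap : T.image (fun s => s + (m : ZMod n)) ⊆ univ \ T := by
    intro x hx
    rw [mem_image] at hx
    obtain ⟨s, hs, rfl⟩ := hx
    rw [mem_sdiff, hT, mem_filter]
    refine ⟨mem_univ _, fun h => ?_⟩
    rw [hT, mem_filter] at hs
    apply hGG _ hs.2 _ h.2
    exact eq_univ_of_forall fun x => mem_arc_union_arc_antipode hn s x
  have h1 : #(T.image (fun s => s + (m : ZMod n))) = #T :=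
    card_image_of_injective _ (add_left_injective _)
  have h2 := card_le_card hmap
  rw [card_sdiff_of_subset (subset_univ _), card_univ, ZMod.card, h1] at h2
  have h3 : #T ≤ n := (card_le_univ T).trans (ZMod.card n).le
  omega

/-- **The arc inequality for a family** (memo Lemma B): for a lower set `G` of finsets of `ZMod (2m)`, `m ≥ 1`, no two members of
which cover everything, the counts `b j = #{s : arc s j ∈ G}` satisfy `Σ_{m ≤ j < 2m} C(2m,j)·b j ≤ 2m + Σ_{1 ≤ j < m} C(2m,j)·b j`.
[this work] -/
theorem arc_ineq_family {m : ℕ} (hm : 1 ≤ m) (hn : n = 2 * m) (hG : IsLowerSet (G : Set (Finset (ZMod n))))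
    (hGG : ∀ x ∈ G, ∀ y ∈ G, x ∪ y ≠ univ) :
    ∑ j ∈ Ico m (2 * m), (((2 * m).choose j : ℤ) *
        (#(univ.filter fun s : ZMod n => (range j).image (fun i : ℕ => s + (i : ZMod n)) ∈ G) : ℤ))
      ≤ 2 * (m : ℤ) + ∑ j ∈ Ico 1 m, (((2 * m).choose j : ℤ) *
        (#(univ.filter fun s : ZMod n => (range j).image (fun i : ℕ => s + (i : ZMod n)) ∈ G) : ℤ)) := by
  refine arc_ineq_abstract m hm (fun j => #(univ.filter fun s : ZMod n => (range j).image (fun i : ℕ => s + (i : ZMod n)) ∈ G))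
    (fun j _ _ => card_arcStarts_succ_le G hG j) (fun j _ _ hpos hlt => ?_) (two_mul_card_arcStarts_mid_le G hn hGG)
  exact card_arcStarts_succ_lt G hG j hpos (by omega)

end Circle

end Summit.CriticalPhenomena.PercolationContinuityZ3.Theorems.ThresholdRAB
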